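import Mathlib
import HarnessLib
import Summits.KontsevichZagierPeriods.Zeta5Search.SorokinIntegrandBounds
import Literature.Analysis.SpecialFunctions.LemniscaticEllipticValuesProofs

/-!
# ζ(5) search — convergence of Zudilin's multiple integral `J_k` (cell `pub-zeta5`, ct-1 g27)

HONEST FRAMING: systematic search; no irrationality claim unless kernel-certified.  A convergence theorem for the TYPED
integrand `Zudilin2002.sorokinIntegrand` of `Literature/NumberTheory/Irrationality/Zudilin2002/WellPoisedIntegrals.lean`;
nothing here is an irrationality result, a worthiness exponent or a denominator statement; no named fact is discharged.

`J_k(a₀; a₁..a_k | b₁..b_k) = ∫_{[0,1]^k} ∏ x_j^{a_j−1}(1−x_j)^{b_j−a_j−1} Q_k(x)^{−a₀} dx` (Zudilin math/0206177 (2); the typed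
`sorokinIntegral` is this Bochner integral, junk `0` when the integrand is not integrable).  The zero set of `Q_k` on the closed
cube is `{x₀=1} ∩ ({x₁=0} ∪ ({x₂=1} ∩ ({x₃=0} ∪ …)))` (0-indexed), so besides the edge conditions `b_j > a_j > 0` integrability
needs the CORNER conditions (`β_j = b_j − a_j`)

  `β₀ + β₂ + ⋯ + β_{2i} + a_{2i+1} > a₀`  (`2i+2 ≤ k`),   `β₀ + β₂ + ⋯ + β_{k−1} > a₀`  (`k` odd);

for Zudilin's parameters `a₀ = h₁, a_j = h_{j+2}, b_j = 1+h₀−h_{j+3}` these are `h₁+⋯+h_{2i+2} < (i+1)(1+h₀)` (from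
`h₁+h₂ < 1+h₀` and the pairs of (6)) and, for odd `k`, EXACTLY the printed (5) `1+h₀ > (2/(k+1))Σh_j`; the printed (6) alone does
not suffice (`J₁` already needs `b₁ − a₁ > a₀`).

* `lintegral_weight_lt_top` — the induction `k+1 → k+2` on the two-exponent family
  `∫ ∏ x_j^{a_j−1}(1−x_j)^{b_j−a_j−1} Q^{−a₀}(1−Q)^{−c₀}` (lintegrals over the open cube for the product of restricted Lebesgue
  measures): `SorokinIntegrandBounds.weight_succ_le` bounds the integrand by a Beta weight in `x₀` times the same family in
  `(x₁,…)` with exponents `(c₀, γ)`; Tonelli (`measurePreserving_piFinSuccAbove`, `lintegral_prod_mul`); the base `k = 1` is a Beta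
  integral; `exists_gap` picks the auxiliary exponent `γ` strictly between `max(a₀−β₀, 0)` and the finitely many corner sums;
* `integrableOn_sorokinIntegrand` — **the typed integrand is integrable on `[0,1]^k`** under `a₀ ≥ 0`, `b_j > a_j > 0` and the
  corner conditions (the `c₀ = 0` case, transported to the closed cube, which differs from the open one by a null set).

Theorems only (no definitions); imports `Zeta5Search/SorokinIntegrandBounds` and, for the real Beta integral
`Literature.Analysis.SpecialFunctions.integrableOn_Ioo_rpow_mul_one_sub_rpow` (PROVED),
`Literature.Analysis.SpecialFunctions.LemniscaticEllipticValuesProofs`.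
-/

noncomputable section

namespace Summit.KontsevichZagierPeriods.Zeta5Search.SorokinConvergence

open MeasureTheory Set Filter
open scoped ENNReal
open Literature.NumberTheory.Irrationality.Zudilin2002 (nestedQ sorokinIntegrand)
open Summit.KontsevichZagierPeriods.Zeta5Search.SorokinIntegrandBounds

/-! ### 1. Elementary helpers -/

/-- A real strictly between a lower bound `L` and finitely many upper bounds `A`, `V`, `U 0, …, U (N−1)`. -/
theorem exists_gap : ∀ (N : ℕ) {L A V : ℝ} {U : ℕ → ℝ}, L < A → L < V → (∀ i, i < N → L < U i) →
    ∃ γ : ℝ, L < γ ∧ γ < A ∧ γ < V ∧ ∀ i, i < N → γ < U i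
  | 0, L, A, V, U, hA, hV, _ =>
    ⟨(L + min A V) / 2, by
      have := lt_min hA hV
      refine ⟨by linarith, ?_, ?_, fun i hi => (Nat.not_lt_zero i hi).elim⟩ <;>
        linarith [min_le_left A V, min_le_right A V]⟩
  | N + 1, L, A, V, U, hA, hV, hU => by
    obtain ⟨γ', h1, h2, h3, h4⟩ := exists_gap N hA hV fun i hi => hU i (Nat.lt_succ_of_lt hi)
    have hN := hU N (Nat.lt_succ_self N)
    refine ⟨min γ' ((L + U N) / 2), lt_min h1 (by linarith), lt_of_le_of_lt (min_le_left _ _) h2,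
      lt_of_le_of_lt (min_le_left _ _) h3, fun i hi => ?_⟩
    rcases Nat.lt_succ_iff_lt_or_eq.1 hi with hi | rfl
    · exact lt_of_le_of_lt (min_le_left _ _) (h4 i hi)
    · exact lt_of_le_of_lt (min_le_right _ _) (by linarith)

/-- The real Beta integral as a finite lintegral: `∫⁻_{(0,1)} t^{u−1}(1−t)^{v−1} < ∞` for `u, v > 0`. -/
theorem lintegral_beta_lt_top {u v : ℝ} (hu : 0 < u) (hv : 0 < v) :
    ∫⁻ t, ENNReal.ofReal (t ^ (u - 1) * (1 - t) ^ (v - 1)) ∂((volume : Measure ℝ).restrict (Ioo 0 1)) < ⊤ := by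
  have h : ∫⁻ t in Ioo (0 : ℝ) 1, ‖t ^ (u - 1) * (1 - t) ^ (v - 1)‖ₑ < ⊤ :=
    (Literature.Analysis.SpecialFunctions.integrableOn_Ioo_rpow_mul_one_sub_rpow hu hv).hasFiniteIntegral
  refine lt_of_le_of_lt (lintegral_mono fun t => ?_) h
  rw [← ofReal_norm, Real.norm_eq_abs]
  exact ENNReal.ofReal_le_ofReal (le_abs_self _)

/-- Almost every point of the product of restricted Lebesgue measures lies in the open cube. -/
theorem ae_mem_openCube (n : ℕ) :
    ∀ᵐ x ∂(Measure.pi fun _ : Fin n => (volume : Measure ℝ).restrict (Ioo 0 1)), ∀ j, x j ∈ Ioo (0 : ℝ) 1 := by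
  have h : (Measure.pi fun _ : Fin n => (volume : Measure ℝ).restrict (Ioo 0 1)) =
      (Measure.pi fun _ : Fin n => (volume : Measure ℝ)).restrict (Set.pi univ fun _ => Ioo (0 : ℝ) 1) :=
    (Measure.restrict_pi_pi _ _).symm
  rw [h]
  filter_upwards [ae_restrict_mem (MeasurableSet.univ_pi fun _ => measurableSet_Ioo)] with x hx
  exact fun j => hx j (mem_univ _)

/-! ### 2. The induction -/

/-- **Finiteness of the two-exponent integrals** on the open cube `(0,1)^{k+1}` (product of restricted Lebesgue measures):
for `a₀, c₀ ≥ 0`, edge conditions `0 < a_j < b_j`, `c₀ < a_0`, and the two interleaved chains of corner conditions (the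
`a₀`-chain from the zero set of `Q_{k+1}`, the `c₀`-chain from that of `1 − Q_{k+1} = x₀ Q_k`), the lintegral of
`∏ x_j^{a_j−1}(1−x_j)^{b_j−a_j−1} Q^{−a₀} (1−Q)^{−c₀}` is finite.  Induction on `k`: Beta base, `weight_succ_le` + Tonelli step. -/
theorem lintegral_weight_lt_top : ∀ (k : ℕ) (a₀ c₀ : ℝ) (a b : ℕ → ℝ), 0 ≤ a₀ → 0 ≤ c₀ →
    (∀ j, j < k + 1 → 0 < a j ∧ a j < b j) → c₀ < a 0 →
    (∀ i, 2 * i + 2 ≤ k + 1 → a₀ < (∑ m ∈ Finset.range (i + 1), (b (2 * m) - a (2 * m))) + a (2 * i + 1)) →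
    (Odd (k + 1) → a₀ < ∑ m ∈ Finset.range ((k + 2) / 2), (b (2 * m) - a (2 * m))) →
    (∀ i, 2 * i + 3 ≤ k + 1 → c₀ < (∑ m ∈ Finset.range (i + 1), (b (2 * m + 1) - a (2 * m + 1))) + a (2 * i + 2)) →
    (Even (k + 1) → c₀ < ∑ m ∈ Finset.range ((k + 1) / 2), (b (2 * m + 1) - a (2 * m + 1))) →
    ∫⁻ x, ENNReal.ofReal ((∏ j : Fin (k + 1), x j ^ (a j - 1) * (1 - x j) ^ (b j - a j - 1)) *
        nestedQ (List.ofFn x) ^ (-a₀) * (1 - nestedQ (List.ofFn x)) ^ (-c₀))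
      ∂(Measure.pi fun _ : Fin (k + 1) => (volume : Measure ℝ).restrict (Ioo 0 1)) < ⊤
  | 0, a₀, c₀, a, b, ha₀, hc₀, hE, hC0, hA, hAodd, hC, hCeven => by
    -- base: `J₁`-type Beta integral `∫ t^{a₀'-c₀-1}(1-t)^{b₀-a₀'-a₀-1}`
    have hβ : a₀ < b 0 - a 0 := by
      have := hAodd (by decide)
      simpa using this
    set μI : Measure ℝ := (volume : Measure ℝ).restrict (Ioo 0 1) with hμI
    set g : ℝ → ℝ≥0∞ := fun t => ENNReal.ofReal ((t ^ (a 0 - 1) * (1 - t) ^ (b 0 - a 0 - 1)) *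
      (1 - t * 1) ^ (-a₀) * (1 - (1 - t * 1)) ^ (-c₀)) with hg
    have hmp := measurePreserving_funUnique μI (Fin 1)
    have heq : (fun x : Fin 1 → ℝ => ENNReal.ofReal ((∏ j : Fin 1, x j ^ (a j - 1) * (1 - x j) ^ (b j - a j - 1)) *
          nestedQ (List.ofFn x) ^ (-a₀) * (1 - nestedQ (List.ofFn x)) ^ (-c₀))) =
        fun x => g (MeasurableEquiv.funUnique (Fin 1) ℝ x) := by
      funext x
      have hQ : nestedQ (List.ofFn x) = 1 - x 0 * 1 := by simp [nestedQ, List.ofFn_succ]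
      rw [hg, hQ, Fin.prod_univ_one]
      rfl
    rw [heq]
    refine lt_of_eq_of_lt (hmp.lintegral_comp_emb (MeasurableEquiv.measurableEmbedding _) g) ?_
    -- compare with the Beta integrand on `(0,1)`
    have hle : ∀ᵐ t ∂μI, g t ≤ ENNReal.ofReal (t ^ ((a 0 - c₀) - 1) * (1 - t) ^ ((b 0 - a 0 - a₀) - 1)) := by
      filter_upwards [ae_restrict_mem measurableSet_Ioo] with t ht
      have ht1 : 0 < 1 - t := by linarith [ht.2]
      rw [hg]
      simp only [mul_one, sub_sub_cancel]
      refine le_of_eq (congrArg ENNReal.ofReal ?_)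
      rw [show (a 0 - c₀) - 1 = (a 0 - 1) + -c₀ by ring, Real.rpow_add ht.1,
        show (b 0 - a 0 - a₀) - 1 = (b 0 - a 0 - 1) + -a₀ by ring, Real.rpow_add ht1]
      ring
    exact lt_of_le_of_lt (lintegral_mono_ae hle) (lintegral_beta_lt_top (by linarith) (by linarith))
  | k + 1, a₀, c₀, a, b, ha₀, hc₀, hE, hC0, hA, hAodd, hC, hCeven => by
    set μI : Measure ℝ := (volume : Measure ℝ).restrict (Ioo 0 1) with hμI
    have hE0 := hE 0 (by omega)
    have hE1 := hE 1 (by omega)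
    -- (1) the auxiliary exponent `γ`
    have hLA : max (a₀ - (b 0 - a 0)) 0 < a 1 := by
      refine max_lt ?_ hE1.1
      have := hA 0 (by omega)
      simp at this
      linarith
    have hLU : ∀ i, i < k / 2 →
        max (a₀ - (b 0 - a 0)) 0 < (∑ m ∈ Finset.range (i + 1), (b (2 * m + 2) - a (2 * m + 2))) + a (2 * i + 3) := by
      intro i hi
      have hpos : 0 < (∑ m ∈ Finset.range (i + 1), (b (2 * m + 2) - a (2 * m + 2))) + a (2 * i + 3) := by
        refine add_pos_of_nonneg_of_pos (Finset.sum_nonneg fun m hm => ?_) (hE (2 * i + 3) (by omega)).1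
        have := hE (2 * m + 2) (by simp at hm; omega)
        linarith
      refine max_lt ?_ hpos
      have h := hA (i + 1) (by omega)
      have hs := Finset.sum_range_succ' (fun m => b (2 * m) - a (2 * m)) (i + 1)
      simp only [mul_add_one, mul_zero] at hs
      rw [hs, show 2 * (i + 1) + 1 = 2 * i + 3 by ring] at h
      linarith
    have hLV : Even (k + 1) →
        max (a₀ - (b 0 - a 0)) 0 < ∑ m ∈ Finset.range ((k + 1) / 2), (b (2 * m + 2) - a (2 * m + 2)) := by
      intro hev
      have hpos : 0 < ∑ m ∈ Finset.range ((k + 1) / 2), (b (2 * m + 2) - a (2 * m + 2)) := by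
        refine Finset.sum_pos (fun m hm => ?_) ⟨0, by simp; obtain ⟨r, hr⟩ := hev; omega⟩
        have := hE (2 * m + 2) (by simp at hm; omega)
        linarith
      refine max_lt ?_ hpos
      have h := hAodd (by obtain ⟨r, hr⟩ := hev; exact ⟨r, by omega⟩)
      have hs := Finset.sum_range_succ' (fun m => b (2 * m) - a (2 * m)) ((k + 1) / 2)
      simp only [mul_add_one, mul_zero] at hs
      rw [show (k + 1 + 2) / 2 = (k + 1) / 2 + 1 by omega, hs] at h
      linarith
    -- dummy `V` when `k+1` is odd
    obtain ⟨γ, hγL, hγA, hγV, hγU⟩ := exists_gap (k / 2) (L := max (a₀ - (b 0 - a 0)) 0) (A := a 1)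
      (V := if Even (k + 1) then ∑ m ∈ Finset.range ((k + 1) / 2), (b (2 * m + 2) - a (2 * m + 2)) else a 1)
      (U := fun i => (∑ m ∈ Finset.range (i + 1), (b (2 * m + 2) - a (2 * m + 2))) + a (2 * i + 3)) hLA
      (by split_ifs with h; exacts [hLV h, hLA]) hLU
    have hγ0 : 0 ≤ γ := le_trans (le_max_right _ _) hγL.le
    have hγβ : a₀ - (b 0 - a 0) < γ := lt_of_le_of_lt (le_max_left _ _) hγL
    have hδ : max (a₀ - γ) 0 < b 0 - a 0 := max_lt (by linarith) (by linarith [hE0.2])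
    -- (2) the induction hypothesis at `(k, c₀, γ, a(·+1), b(·+1))`
    have IH := lintegral_weight_lt_top k c₀ γ (fun n => a (n + 1)) (fun n => b (n + 1)) hc₀ hγ0
      (fun j hj => hE (j + 1) (by omega)) hγA
      (fun i hi => hC i (by omega))
      (fun hodd => hCeven (by obtain ⟨r, hr⟩ := hodd; exact ⟨r + 1, by omega⟩))
      (fun i hi => hγU i (by omega))
      (fun hev => by have := hγV; rw [if_pos hev] at this; exact this)
    -- (3) the Beta factor in `x₀`
    have hBeta := lintegral_beta_lt_top (u := a 0 - c₀) (v := b 0 - a 0 - max (a₀ - γ) 0) (by linarith) (by linarith)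
    -- (4) the pointwise bound, a.e. on the open cube
    set G : (Fin (k + 2) → ℝ) → ℝ≥0∞ := fun x => ENNReal.ofReal ((∏ j : Fin (k + 2), x j ^ (a j - 1) * (1 - x j) ^ (b j - a j - 1)) *
        nestedQ (List.ofFn x) ^ (-a₀) * (1 - nestedQ (List.ofFn x)) ^ (-c₀)) with hG
    set g : ℝ → ℝ≥0∞ := fun t => ENNReal.ofReal (t ^ ((a 0 - c₀) - 1) * (1 - t) ^ ((b 0 - a 0 - max (a₀ - γ) 0) - 1)) with hg
    set H : (Fin (k + 1) → ℝ) → ℝ≥0∞ := fun x' => ENNReal.ofReal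
      ((∏ j : Fin (k + 1), x' j ^ ((fun n => a (n + 1)) j - 1) * (1 - x' j) ^ ((fun n => b (n + 1)) j - (fun n => a (n + 1)) j - 1)) *
        nestedQ (List.ofFn x') ^ (-c₀) * (1 - nestedQ (List.ofFn x')) ^ (-γ)) with hH
    have hbound : ∀ᵐ x ∂(Measure.pi fun _ : Fin (k + 2) => μI),
        G x ≤ ENNReal.ofReal ((2 : ℝ) ^ a₀) * (g (x 0) * H (fun j => x j.succ)) := by
      filter_upwards [ae_mem_openCube (k + 2)] with x hx
      obtain ⟨t, x', rfl⟩ : ∃ t x', Fin.cons t x' = x := ⟨x 0, Fin.tail x, Fin.cons_self_tail x⟩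
      have ht : t ∈ Ioo (0 : ℝ) 1 := by simpa using hx 0
      have hx' : ∀ j, x' j ∈ Ioo (0 : ℝ) 1 := fun j => by simpa using hx j.succ
      have hw := weight_succ_le (k := k + 1) (by omega) ha₀ hγ0 c₀ a b ht hx'
      have hgt : 0 ≤ t ^ (a 0 - c₀ - 1) * (1 - t) ^ (b 0 - a 0 - max (a₀ - γ) 0 - 1) :=
        mul_nonneg (Real.rpow_nonneg ht.1.le _) (Real.rpow_nonneg (by linarith [ht.2]) _)
      rw [hG, hg, hH]
      simp only [Fin.cons_zero, Fin.cons_succ]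
      calc _ ≤ ENNReal.ofReal ((2 : ℝ) ^ a₀ * (t ^ (a 0 - c₀ - 1) * (1 - t) ^ (b 0 - a 0 - max (a₀ - γ) 0 - 1)) *
            ((∏ j : Fin (k + 1), x' j ^ (a ((j : ℕ) + 1) - 1) * (1 - x' j) ^ (b ((j : ℕ) + 1) - a ((j : ℕ) + 1) - 1)) *
              nestedQ (List.ofFn x') ^ (-c₀) * (1 - nestedQ (List.ofFn x')) ^ (-γ))) := ENNReal.ofReal_le_ofReal hw
        _ = _ := by
            rw [ENNReal.ofReal_mul (mul_nonneg (by positivity) hgt), ENNReal.ofReal_mul (by positivity : (0 : ℝ) ≤ 2 ^ a₀),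
              mul_assoc]
    -- (5) Tonelli
    have hmp := measurePreserving_piFinSuccAbove (fun _ : Fin (k + 2) => μI) 0
    have hgm : Measurable g := by
      rw [hg]
      exact (((measurable_id.pow_const _).mul ((measurable_const.sub measurable_id).pow_const _))).ennreal_ofReal
    have hHm : Measurable H := by
      rw [hH]
      exact (measurable_weight (k + 1) c₀ γ (fun n => a (n + 1)) (fun n => b (n + 1))).ennreal_ofReal
    have hprod : ∫⁻ x, g (x 0) * H (fun j => x j.succ) ∂(Measure.pi fun _ : Fin (k + 2) => μI) =
        (∫⁻ t, g t ∂μI) * ∫⁻ x', H x' ∂(Measure.pi fun _ : Fin (k + 1) => μI) := by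
      have h1 := hmp.lintegral_comp_emb (MeasurableEquiv.measurableEmbedding _) (fun p => g p.1 * H p.2)
      have h2 : (fun x : Fin (k + 2) → ℝ => (fun p : ℝ × (Fin (k + 1) → ℝ) => g p.1 * H p.2)
          (MeasurableEquiv.piFinSuccAbove (fun _ => ℝ) 0 x)) = fun x => g (x 0) * H (fun j => x j.succ) := by
        funext x
        simp only [MeasurableEquiv.piFinSuccAbove_apply, Fin.insertNthEquiv_symm_apply]
        congr 1
      rw [h2] at h1
      rw [h1, lintegral_prod_mul hgm.aemeasurable hHm.aemeasurable]
    -- (6) assemble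
    calc ∫⁻ x, G x ∂(Measure.pi fun _ : Fin (k + 2) => μI)
        ≤ ∫⁻ x, ENNReal.ofReal ((2 : ℝ) ^ a₀) * (g (x 0) * H (fun j => x j.succ)) ∂(Measure.pi fun _ : Fin (k + 2) => μI) :=
          lintegral_mono_ae hbound
      _ = ENNReal.ofReal ((2 : ℝ) ^ a₀) * ((∫⁻ t, g t ∂μI) * ∫⁻ x', H x' ∂(Measure.pi fun _ : Fin (k + 1) => μI)) := by
          rw [lintegral_const_mul' _ _ ENNReal.ofReal_ne_top, hprod]
      _ < ⊤ := ENNReal.mul_lt_top ENNReal.ofReal_lt_top (ENNReal.mul_lt_top hBeta IH)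

/-! ### 3. Integrability of the typed integrand -/

/-- **Convergence of Zudilin's `J_k`** (typed form): for `k ≥ 1`, `a₀ ≥ 0`, edge conditions `0 < a_j < b_j` (`j < k`) and the
corner conditions `a₀ < (b₀−a₀') + (b₂−a₂) + ⋯ + (b_{2i}−a_{2i}) + a_{2i+1}` (`2i+2 ≤ k`) and, for odd `k`,
`a₀ < (b₀−a₀') + (b₂−a₂) + ⋯ + (b_{k−1}−a_{k−1})` (0-indexed parameters `a j`, `b j` as in the typed `sorokinIntegrand`),
the integrand `∏ x_j^{a_j−1}(1−x_j)^{b_j−a_j−1}/Q_k(x)^{a₀}` is integrable on the closed cube `[0,1]^k` — so the typed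
`sorokinIntegral k a₀ a b` is an honest integral there. [Zudilin math/0206177, (2)–(3) with (5)–(6); the corner form is ours] -/
theorem integrableOn_sorokinIntegrand {k : ℕ} (hk : 1 ≤ k) {a₀ : ℝ} (ha₀ : 0 ≤ a₀) {a b : ℕ → ℝ}
    (hE : ∀ j, j < k → 0 < a j ∧ a j < b j)
    (hA : ∀ i, 2 * i + 2 ≤ k → a₀ < (∑ m ∈ Finset.range (i + 1), (b (2 * m) - a (2 * m))) + a (2 * i + 1))
    (hAodd : Odd k → a₀ < ∑ m ∈ Finset.range ((k + 1) / 2), (b (2 * m) - a (2 * m))) :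
    IntegrableOn (sorokinIntegrand k a₀ a b) (Set.pi univ fun _ : Fin k => Icc (0 : ℝ) 1) volume := by
  obtain ⟨n, rfl⟩ : ∃ n, k = n + 1 := ⟨k - 1, by omega⟩
  set μI : Measure ℝ := (volume : Measure ℝ).restrict (Ioo 0 1) with hμI
  -- the closed cube and the open cube differ by a null set
  have hae : (Set.pi univ fun _ : Fin (n + 1) => Ioo (0 : ℝ) 1) =ᵐ[volume] (Set.pi univ fun _ : Fin (n + 1) => Icc (0 : ℝ) 1) := by
    rw [volume_pi]; exact Measure.pi_Ioo_ae_eq_pi_Icc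
  refine IntegrableOn.congr_set_ae ?_ hae.symm
  -- measurability
  have hQ := (continuous_nestedQ_ofFn (n + 1)).measurable
  have hmeas : Measurable (sorokinIntegrand (n + 1) a₀ a b) := by
    refine Measurable.div (Finset.measurable_prod _ fun j _ => ?_) (hQ.pow_const _)
    exact ((measurable_pi_apply j).pow_const _).mul ((measurable_const.sub (measurable_pi_apply j)).pow_const _)
  refine ⟨hmeas.aestronglyMeasurable, ?_⟩
  -- finiteness of the lintegral on the open cube = the `c₀ = 0` case of the induction
  rw [HasFiniteIntegral, volume_pi, Measure.restrict_pi_pi]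
  have hfin := lintegral_weight_lt_top n a₀ 0 a b ha₀ le_rfl hE (hE 0 (by omega)).1 hA hAodd
    (fun i hi => add_pos_of_nonneg_of_pos (Finset.sum_nonneg fun m hm => by
        have := hE (2 * m + 1) (by simp at hm; omega); linarith) (hE (2 * i + 2) (by omega)).1)
    (fun hev => Finset.sum_pos (fun m hm => by have := hE (2 * m + 1) (by simp at hm; omega); linarith)
        ⟨0, by simp; obtain ⟨r, hr⟩ := hev; omega⟩)
  refine lt_of_le_of_lt (le_of_eq (lintegral_congr_ae ?_)) hfin
  filter_upwards [ae_mem_openCube (n + 1)] with x hx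
  have hxc : ∀ j, x j ∈ Icc (0 : ℝ) 1 := fun j => Ioo_subset_Icc_self (hx j)
  have hnn : 0 ≤ sorokinIntegrand (n + 1) a₀ a b x := by
    unfold sorokinIntegrand
    exact div_nonneg (Finset.prod_nonneg fun j _ => mul_nonneg (Real.rpow_nonneg (hxc j).1 _)
      (Real.rpow_nonneg (by linarith [(hxc j).2]) _)) (Real.rpow_nonneg (nestedQ_ofFn_mem_Icc hxc).1 _)
  rw [Real.enorm_eq_ofReal hnn, sorokinIntegrand_eq (n + 1) a₀ a b hxc]

end Summit.KontsevichZagierPeriods.Zeta5Search.SorokinConvergence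

end
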